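import Literature.Probability.Percolation.TriCoarseTiling
import Literature.Probability.Percolation.TriOneBlock
import HarnessLib

/-!
# Discrete domains from unions of tiles

Topic `Literature/Probability/Percolation`; family `crit-perc`. The end of the combinatorial
layer of the construction of the lattice approximations of a Jordan domain (Bollobás–Riordan,
*Percolation* (2006), Ch. 7, Lemma 14): **any finite nonempty coarse set of tile centres,
connected with connected complement, yields a discrete domain** `TriMarkedDomain 0` — the
union of its tiles (`TriCoarseTiling.lean`) — with all the standing properties of B–R's
discrete domains (§7.2.2 p. 168), the cut-vertex conditions coming for free from the one-block
ring patterns of unions of tiles (`TriOneBlock.lean`).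

* `pathIn_of_coarse` — coarse lattice paths lift to fine paths through the tiles
  (`pathIn_to_centre`: a site is joined to the scaled centre of its tile inside the tile;
  `exists_touch`: adjacent tiles have adjacent sites); hence `pathIn_tileUnion` (connected)
  and `pathIn_compl_tileUnion` (complement connected);
* `oneBlockAt_tileUnion`; `TriMarkedDomain.ofTileUnion` — the constructor.

## References

* B. Bollobás, O. Riordan, *Percolation*, Cambridge University Press (2006), Ch. 7 §7.2.2
  p. 168, §7.2.5 p. 190.

## Mathlib / tree

Tree: `TriCoarseTiling.lean`, `TriOneBlock.lean` (`OneBlockAt`, `TriMarkedDomain.ofOneBlock`),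
`SitePaths.lean` (`PathIn`).
-/

noncomputable section

open Finset Literature.Probability.LatticeModels

namespace Literature.Probability.Percolation

/-- **The sites of the ball of radius `2`**: `0`, the six units, and the twelve sums of two
units (read off the representatives). [folklore] -/
theorem tileRep_cases (k : ZMod 19) :
    tileRep k = 0 ∨ (∃ j : Fin 6, tileRep k = triDir j) ∨ ∃ j i : Fin 6, tileRep k = triDir j + triDir i := by
  revert k; decide

/-- **Adjacent tiles touch**: for each coarse direction `e_j` there are sites of the tiles of `0`
and of `e_j` which are adjacent. [folklore] -/
theorem exists_touch (j : Fin 6) :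
    ∃ p q : ZMod 19, ∃ i : Fin 6, coarseMul (triDir j) + tileRep q = tileRep p + triDir i := by
  revert j; decide

/-- The coarse centre of a site of a tile given by a small offset. [folklore] -/
theorem tileCentre_coarseMul_add_of_triNorm_le (c : Site 2) {b : Site 2} (hb : triNorm b ≤ 2) :
    tileCentre (coarseMul c + b) = c := by
  rw [← tileRep_tilePhi_of_triNorm_le hb, tileCentre_coarseMul_add_tileRep]

/-- The hexagonal norm of a unit direction is `1`. [folklore] -/
theorem triNorm_triDir (j : Fin 6) : triNorm (triDir j) = 1 := by
  revert j; decide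

/-- **Every site is joined to the scaled centre of its tile inside its tile.** [folklore] -/
theorem pathIn_to_centre (x : Site 2) :
    PathIn triGraph {z : Site 2 | tileCentre z = tileCentre x} x (coarseMul (tileCentre x)) := by
  set c := tileCentre x with hc
  have hx : x = coarseMul c + tileRep (tilePhi x) := (coarseMul_tileCentre_add x).symm
  have h0 : coarseMul c ∈ {z : Site 2 | tileCentre z = c} := by
    show tileCentre (coarseMul c) = c
    simpa using tileCentre_coarseMul_add_of_triNorm_le c (b := 0) (by decide)
  rcases tileRep_cases (tilePhi x) with h | ⟨j, hj⟩ | ⟨j, i, hji⟩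
  · rw [h, add_zero] at hx
    rw [hx] at hc ⊢; simpa using PathIn.refl h0
  · have h1 : coarseMul c + triDir j ∈ {z : Site 2 | tileCentre z = c} :=
      tileCentre_coarseMul_add_of_triNorm_le c (by rw [triNorm_triDir]; decide)
    rw [hj] at hx
    conv_lhs => rw [hx]
    exact (PathIn.of_adj h1 h0 (triGraph_adj_add_triDir _ j).symm)
  · have h1 : coarseMul c + triDir j ∈ {z : Site 2 | tileCentre z = c} :=
      tileCentre_coarseMul_add_of_triNorm_le c (by rw [triNorm_triDir]; decide)
    have h2 : coarseMul c + (triDir j + triDir i) ∈ {z : Site 2 | tileCentre z = c} := by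
      rw [← hji]; exact tileCentre_coarseMul_add_tileRep c _
    rw [hji] at hx
    conv_lhs => rw [hx]
    refine (PathIn.of_adj h2 h1 ?_).trans (PathIn.of_adj h1 h0 (triGraph_adj_add_triDir _ j).symm)
    rw [← add_assoc]; exact (triGraph_adj_add_triDir _ i).symm

/-- **Coarse paths lift to fine paths through the tiles**: if the coarse centres of `x` and
`y` are joined by a coarse lattice path inside `T`, then `x` and `y` are joined by a lattice
path through sites whose tiles have centres in `T`. [folklore] -/
theorem pathIn_of_coarse {T : Set (Site 2)} {x y : Site 2} (h : PathIn triGraph T (tileCentre x) (tileCentre y)) :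
    PathIn triGraph {z : Site 2 | tileCentre z ∈ T} x y := by
  -- paths inside one tile lie in the lifted set when the tile is in `T`
  have inTile : ∀ {u v : Site 2} (c : Site 2), c ∈ T → PathIn triGraph {z : Site 2 | tileCentre z = c} u v →
      PathIn triGraph {z : Site 2 | tileCentre z ∈ T} u v := fun c hc p =>
    p.mono fun z hz => by show tileCentre z ∈ T; rw [show tileCentre z = c from hz]; exact hc
  obtain ⟨hxT, hR⟩ := h
  -- induction along the coarse path, ending at the scaled centre
  have key : ∀ c, Relation.ReflTransGen (fun a b => triGraph.Adj a b ∧ b ∈ T) (tileCentre x) c →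
      PathIn triGraph {z : Site 2 | tileCentre z ∈ T} x (coarseMul c) := by
    intro c hc
    induction hc with
    | refl => exact inTile _ hxT (pathIn_to_centre x)
    | @tail b c _ hbc ih =>
      obtain ⟨j, rfl⟩ := (triGraph_adj_iff_triDir b c).1 hbc.1
      have hbT : b ∈ T := by
        have h := PathIn.right_mem (G := triGraph) (show PathIn triGraph {z | tileCentre z ∈ T} x (coarseMul b) from ih)
        have e : tileCentre (coarseMul b) = b := by
          simpa using tileCentre_coarseMul_add_of_triNorm_le b (b := 0) (by decide)
        simpa [e] using h
      obtain ⟨p, q, i, hpq⟩ := exists_touch j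
      -- `u = αb + rep p` in the tile of `b`, `v = α(b + e_j) + rep q` in the next tile, adjacent
      set u := coarseMul b + tileRep p with hu
      set v := coarseMul (b + triDir j) + tileRep q with hv
      have huv : v = u + triDir i := by
        rw [hv, hu, coarseMul_add, add_assoc, hpq, ← add_assoc]
      have hu_c : tileCentre u = b := tileCentre_coarseMul_add_tileRep b p
      have hv_c : tileCentre v = b + triDir j := tileCentre_coarseMul_add_tileRep _ q
      -- `αb → u` inside the tile of `b`, `u → v`, `v → α(b + e_j)` inside the next tile
      have h1 : PathIn triGraph {z : Site 2 | tileCentre z ∈ T} (coarseMul b) u := by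
        have := pathIn_to_centre u
        rw [hu_c] at this
        exact (inTile b hbT this).symm
      have h2 : PathIn triGraph {z : Site 2 | tileCentre z ∈ T} u v :=
        PathIn.of_adj (show tileCentre u ∈ T by rw [hu_c]; exact hbT)
          (show tileCentre v ∈ T by rw [hv_c]; exact hbc.2) (by rw [huv]; exact triGraph_adj_add_triDir u i)
      have h3 : PathIn triGraph {z : Site 2 | tileCentre z ∈ T} v (coarseMul (b + triDir j)) := by
        have := pathIn_to_centre v
        rw [hv_c] at this
        exact inTile _ hbc.2 this
      exact ((ih.trans h1).trans h2).trans h3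
  have hy := pathIn_to_centre y
  have hyT : tileCentre y ∈ T := (PathIn.right_mem (G := triGraph) (show PathIn triGraph T _ _ from ⟨hxT, hR⟩))
  exact (key _ hR).trans (inTile _ hyT hy).symm

/-- **A union of tiles over a connected coarse set is connected.** [folklore] -/
theorem pathIn_tileUnion {S' : Finset (Site 2)} (hconn : ∀ c ∈ S', ∀ c' ∈ S', PathIn triGraph (↑S' : Set (Site 2)) c c')
    {x y : Site 2} (hx : x ∈ tileUnion S') (hy : y ∈ tileUnion S') :
    PathIn triGraph (↑(tileUnion S') : Set (Site 2)) x y := by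
  rw [mem_tileUnion_iff] at hx hy
  have e : (↑(tileUnion S') : Set (Site 2)) = {z | tileCentre z ∈ (↑S' : Set (Site 2))} := by
    ext z; simp [mem_tileUnion_iff]
  rw [e]
  exact pathIn_of_coarse (hconn _ hx _ hy)

/-- **The complement of a union of tiles over a co-connected coarse set is connected.** [folklore] -/
theorem pathIn_compl_tileUnion {S' : Finset (Site 2)}
    (hco : ∀ o ∉ S', ∀ o' ∉ S', PathIn triGraph ((↑S' : Set (Site 2))ᶜ) o o')
    {x y : Site 2} (hx : x ∉ tileUnion S') (hy : y ∉ tileUnion S') :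
    PathIn triGraph ((↑(tileUnion S') : Set (Site 2))ᶜ) x y := by
  rw [mem_tileUnion_iff] at hx hy
  have e : ((↑(tileUnion S') : Set (Site 2))ᶜ) = {z | tileCentre z ∈ ((↑S' : Set (Site 2))ᶜ)} := by
    ext z; simp [mem_tileUnion_iff]
  rw [e]
  exact pathIn_of_coarse (hco _ hx _ hy)

/-! ### The constructor -/

/-- The scaled centre of a tile lies in the union when the centre is selected. [folklore] -/
theorem coarseMul_mem_tileUnion {S' : Finset (Site 2)} {c : Site 2} (hc : c ∈ S') : coarseMul c ∈ tileUnion S' := by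
  rw [mem_tileUnion_iff]
  have e : tileCentre (coarseMul c) = c := by
    simpa using tileCentre_coarseMul_add_of_triNorm_le c (b := 0) (by decide)
  rw [e]; exact hc

/-- **Unions of tiles have one-block ring patterns** (`isCyclicBlock_tileUnion`, in the form
`OneBlockAt`). [folklore] -/
theorem oneBlockAt_tileUnion (S' : Finset (Site 2)) (x : Site 2) : OneBlockAt (tileUnion S') x := by
  rcases isCyclicBlock_tileUnion S' x with h | h | ⟨a, m, hm, hb⟩
  · left; intro j; simpa using h j
  · right; left; intro j; simpa using h j
  · right; right; exact ⟨a, m, hm, fun t => by simpa using hb t⟩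

/-- **A discrete domain from a coarse polyhex**: the union of the tiles with centres in a
finite nonempty coarse set `S'` which is connected with connected complement (in the coarse
lattice `𝕋`) is an unmarked discrete domain of Bollobás–Riordan — connected, simply connected,
its boundary one cycle, and neither it nor its outer boundary having a cut vertex (2006, Ch. 7
§7.2.2 p. 168). [cite: BollobasRiordan2006, Ch. 7 §7.2.2 p. 168] -/
def TriMarkedDomain.ofTileUnion (S' : Finset (Site 2)) (hne : S'.Nonempty)
    (hconn : ∀ c ∈ S', ∀ c' ∈ S', PathIn triGraph (↑S' : Set (Site 2)) c c')
    (hco : ∀ o ∉ S', ∀ o' ∉ S', PathIn triGraph ((↑S' : Set (Site 2))ᶜ) o o') : TriMarkedDomain 0 :=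
  TriMarkedDomain.ofOneBlock (tileUnion S') ⟨coarseMul hne.choose, coarseMul_mem_tileUnion hne.choose_spec⟩
    (fun _ hx _ hy => pathIn_tileUnion hconn hx hy) (fun _ hx _ hy => pathIn_compl_tileUnion hco hx hy)
    (fun x _ => oneBlockAt_tileUnion S' x)

/-- The site set of `ofTileUnion`. [folklore] -/
@[simp] theorem TriMarkedDomain.ofTileUnion_verts (S' : Finset (Site 2)) (hne : S'.Nonempty) (hconn) (hco) :
    (TriMarkedDomain.ofTileUnion S' hne hconn hco).verts = tileUnion S' := rfl

end Literature.Probability.Percolation
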